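import Mathlib
import Literature.Probability.MarkovChains.TotalVariation
import Literature.Probability.MarkovChains.MengersenTweedie
import Summits.Ventures.LatticeQCDFlow.Exactness.FlowMCMC
import Summits.Ventures.LatticeQCDFlow.Scaling.ImportanceWeights

/-!
# LatticeQCDFlow / Scaling — the relaxation time of a full-lattice independence sampler is
# `w⋆ = ∏ blocks w⋆_block`: exponential in the volume (V2, typed barrier B1 for family A)

HONEST FRAMING: exact (Metropolis-corrected) sampling algorithms for lattice gauge theory;
figures of merit are autocorrelation/cost numbers at stated couplings and volumes; no
continuum-physics claim.

Venture `LatticeQCDFlow` (cell pub-lqcd), topic `Scaling`, item V2 of HOME/SCOPING.md §5 /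
VENTURE-STATEMENT.md ("Mengersen–Tweedie NAMED FACT + corollary gap ≤ w₁⋆^{−V/V₀}"), FANOUT row 31.
The cited fact is the tree's `Literature/Probability/MarkovChains/MengersenTweedie.lean`
(Mengersen–Tweedie 1996 Thm 2.1, rate `1 − 1/w⋆`; Wang 2022 Thm 2, the rate is exact from the
mode of `w = p/q`).  Here it is instantiated for the flow-MCMC chain `Exactness.imhKernel p q`
(row 30) with target and model that FACTORISE over `m` blocks (`Theory2.blockProd`, row 31's
`Scaling/ImportanceWeights.lean`): the weight bound multiplies, `w⋆ = ∏ᵢ w⋆ᵢ`, and is attained at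
the product of the block modes, so

* `imh_blockProd_tvDist_le` — from every start `‖μPᵗ − p‖_TV ≤ (1 − ∏ᵢ Wᵢ⁻¹)ᵗ`;
* `imh_blockProd_tvDist_mode` — from the product mode `zs`,
  `‖δ_{zs}Pᵗ − p‖_TV = (1 − ∏ᵢ Wᵢ⁻¹)ᵗ · (1 − ∏ᵢ pbᵢ(zsᵢ))` EXACTLY;
* `imh_mixing_time_ge` (any law with weight bound `W` attained at `x⋆`) and
  `imh_blockProd_mixing_time_ge` — `ε`-closeness from the mode needs
  `t ≥ W · (1 − ε/(1 − p x⋆))` steps, `W = ∏ᵢ Wᵢ` (`= W₁^m` for identical blocks,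
  `imh_blockProd_const_mixing_time_ge`): at fixed local model quality `W₁ > 1` the relaxation
  time of the exact full-lattice independence sampler grows like `W₁^{V/V₀}`.
This is a theorem about product laws (the factorised MODEL regime of Abbott et al. 2022 §V), the
typed form of barrier B1 for single global flows used as IMH proposals; the companion ESS law is
`Theory2.essFrac_blockProd_const`.
-/

namespace Summit.Ventures.LatticeQCDFlow.Theory2

open Finset
open Literature.Probability.MarkovChains
open Summit.Ventures.LatticeQCDFlow.Exactness

section OneLaw

variable {X : Type*} [Fintype X] [DecidableEq X]

/-- **Mixing-time form of the exact rate.**  If `p ≤ W·q` with equality at `x⋆`, and the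
flow-MCMC chain started AT `x⋆` is `ε`-close to `p` in total variation at time `t`, then
`W · (1 − p x⋆ − ε) ≤ t · (1 − p x⋆)`, i.e. `t ≥ W (1 − ε/(1 − p x⋆))`: the relaxation time is
at least `w⋆` up to the stated factor (Bernoulli's inequality on Wang's exact law
`imh_tvDist_lawAt_mode`). [folklore] -/
theorem imh_mixing_time_ge {p q : X → ℝ} {W : ℝ} (hp : ∀ x, 0 < p x) (hp1 : ∑ x, p x = 1)
    (hq : ∀ x, 0 ≤ q x) (hq1 : ∑ x, q x = 1) (hW : ∀ x, p x ≤ W * q x) {xs : X}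
    (hxs : p xs = W * q xs) {t : ℕ} {ε : ℝ}
    (h : tvDist (lawAt (imhKernel p q) (Pi.single xs 1) t) p ≤ ε) :
    W * (1 - p xs - ε) ≤ t * (1 - p xs) := by
  have hexact : tvDist (lawAt (imhKernel p q) (Pi.single xs 1) t) p =
      (1 - W⁻¹) ^ t * (1 - p xs) := imh_tvDist_lawAt_mode hp hp1 hq hq1 hW hxs t
  have hW0 : 0 < W := pos_of_mul_pos_left ((hp xs).trans_le (hW xs)) (hq xs)
  have hW1 : 1 ≤ W := by
    have hs : ∑ x, p x ≤ ∑ x, W * q x := sum_le_sum fun x _ => hW x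
    rwa [hp1, ← mul_sum, hq1, mul_one] at hs
  have hps : p xs ≤ 1 := by
    rw [← hp1]; exact single_le_sum (fun y _ => (hp y).le) (mem_univ xs)
  -- Bernoulli: `1 − t/W ≤ (1 − 1/W)^t`
  have hbern : 1 + (t : ℝ) * (-W⁻¹) ≤ (1 + (-W⁻¹)) ^ t :=
    one_add_mul_le_pow (by have := inv_le_one_of_one_le₀ hW1; linarith) t
  have hb : (1 - (t : ℝ) * W⁻¹) * (1 - p xs) ≤ (1 - W⁻¹) ^ t * (1 - p xs) := by
    have e1 : 1 - (t : ℝ) * W⁻¹ = 1 + (t : ℝ) * (-W⁻¹) := by ring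
    have e2 : (1 : ℝ) - W⁻¹ = 1 + (-W⁻¹) := by ring
    rw [e1, e2]
    exact mul_le_mul_of_nonneg_right hbern (by linarith)
  have hmain : (1 - (t : ℝ) * W⁻¹) * (1 - p xs) ≤ ε := by linarith [hexact ▸ h]
  -- multiply through by `W > 0`
  have e3 : W * ((1 - (t : ℝ) * W⁻¹) * (1 - p xs)) = W * (1 - p xs) - t * (1 - p xs) := by
    field_simp
  have h4 : W * ((1 - (t : ℝ) * W⁻¹) * (1 - p xs)) ≤ W * ε := mul_le_mul_of_nonneg_left hmain hW0.le
  rw [e3] at h4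
  linarith

end OneLaw

section Blocks

variable {m : ℕ} {Z : Type*} [Fintype Z] [DecidableEq Z]

omit [Fintype Z] [DecidableEq Z] in
/-- A block-wise weight bound multiplies: `pbᵢ ≤ Wᵢ·qbᵢ` for all blocks gives
`⊗pb ≤ (∏ Wᵢ)·⊗qb`. [folklore] -/
theorem blockProd_le_prod_mul_blockProd {pb qb : Fin m → Z → ℝ} {W : Fin m → ℝ}
    (hp : ∀ i z, 0 ≤ pb i z) (hW : ∀ i z, pb i z ≤ W i * qb i z) (φ : Fin m → Z) :
    blockProd pb φ ≤ (∏ i, W i) * blockProd qb φ := by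
  unfold blockProd
  rw [← prod_mul_distrib]
  exact prod_le_prod (fun i _ => hp i (φ i)) (fun i _ => hW i (φ i))

omit [Fintype Z] [DecidableEq Z] in
/-- The product weight bound is attained at the product of the block modes. [folklore] -/
theorem blockProd_eq_prod_mul_blockProd_of_modes {pb qb : Fin m → Z → ℝ} {W : Fin m → ℝ}
    {zs : Fin m → Z} (hzs : ∀ i, pb i (zs i) = W i * qb i (zs i)) :
    blockProd pb zs = (∏ i, W i) * blockProd qb zs := by
  unfold blockProd
  rw [← prod_mul_distrib]
  exact prod_congr rfl fun i _ => hzs i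

omit [DecidableEq Z] in
/-- A block product of probability vectors is a probability vector. [folklore] -/
theorem sum_blockProd_eq_one {qb : Fin m → Z → ℝ} (hq1 : ∀ i, ∑ z, qb i z = 1) :
    ∑ φ, blockProd qb φ = 1 := by
  rw [sum_blockProd]; exact prod_eq_one fun i _ => hq1 i

omit [Fintype Z] [DecidableEq Z] in
/-- A block product of non-negative laws is non-negative. [folklore] -/
theorem blockProd_nonneg {qb : Fin m → Z → ℝ} (hq : ∀ i z, 0 ≤ qb i z) (φ : Fin m → Z) :
    0 ≤ blockProd qb φ :=
  prod_nonneg fun i _ => hq i (φ i)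

/-- **V2, upper bound (Mengersen–Tweedie for a factorised flow sampler).**  With block-wise weight
bounds `pbᵢ ≤ Wᵢ·qbᵢ`, the flow-MCMC chain for `p = ⊗pb`, `q = ⊗qb` converges from every start at
rate `1 − ∏ᵢ Wᵢ⁻¹`: `‖μPᵗ − p‖_TV ≤ (1 − (∏ᵢ Wᵢ)⁻¹)ᵗ`. [folklore] -/
theorem imh_blockProd_tvDist_le {pb qb : Fin m → Z → ℝ} {W : Fin m → ℝ}
    (hp : ∀ i z, 0 < pb i z) (hp1 : ∀ i, ∑ z, pb i z = 1) (hq : ∀ i z, 0 ≤ qb i z)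
    (hq1 : ∀ i, ∑ z, qb i z = 1) (hW : ∀ i z, pb i z ≤ W i * qb i z)
    {μ : (Fin m → Z) → ℝ} (hμ : ∀ φ, 0 ≤ μ φ) (hμ1 : ∑ φ, μ φ = 1) (t : ℕ) :
    tvDist (lawAt (imhKernel (blockProd pb) (blockProd qb)) μ t) (blockProd pb) ≤
      (1 - (∏ i, W i)⁻¹) ^ t :=
  imh_tvDist_lawAt_le (blockProd_pos hp) (sum_blockProd_eq_one hp1) (blockProd_nonneg hq)
    (sum_blockProd_eq_one hq1) (blockProd_le_prod_mul_blockProd (fun i z => (hp i z).le) hW)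
    hμ hμ1 t

/-- **V2, exactness (Wang / Liu for a factorised flow sampler).**  If moreover each `Wᵢ` is
attained at a block configuration `zsᵢ`, then from the product mode `zs` the law of the exact
chain is known in closed form and
`‖δ_{zs}Pᵗ − p‖_TV = (1 − (∏ᵢ Wᵢ)⁻¹)ᵗ · (1 − ∏ᵢ pbᵢ(zsᵢ))` — the rate `1 − 1/∏ᵢ Wᵢ` is exact.
[folklore] -/
theorem imh_blockProd_tvDist_mode {pb qb : Fin m → Z → ℝ} {W : Fin m → ℝ}
    (hp : ∀ i z, 0 < pb i z) (hp1 : ∀ i, ∑ z, pb i z = 1) (hq : ∀ i z, 0 ≤ qb i z)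
    (hq1 : ∀ i, ∑ z, qb i z = 1) (hW : ∀ i z, pb i z ≤ W i * qb i z)
    {zs : Fin m → Z} (hzs : ∀ i, pb i (zs i) = W i * qb i (zs i)) (t : ℕ) :
    tvDist (lawAt (imhKernel (blockProd pb) (blockProd qb)) (Pi.single zs 1) t) (blockProd pb) =
      (1 - (∏ i, W i)⁻¹) ^ t * (1 - ∏ i, pb i (zs i)) :=
  imh_tvDist_lawAt_mode (blockProd_pos hp) (sum_blockProd_eq_one hp1) (blockProd_nonneg hq)
    (sum_blockProd_eq_one hq1) (blockProd_le_prod_mul_blockProd (fun i z => (hp i z).le) hW)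
    (blockProd_eq_prod_mul_blockProd_of_modes hzs) t

/-- **V2, mixing-time form.**  From the product mode, `ε`-closeness of the exact factorised
flow-MCMC chain needs `(∏ᵢ Wᵢ) · (1 − p(zs) − ε) ≤ t · (1 − p(zs))` — relaxation time
`≳ ∏ᵢ w⋆ᵢ`. [folklore] -/
theorem imh_blockProd_mixing_time_ge {pb qb : Fin m → Z → ℝ} {W : Fin m → ℝ}
    (hp : ∀ i z, 0 < pb i z) (hp1 : ∀ i, ∑ z, pb i z = 1) (hq : ∀ i z, 0 ≤ qb i z)
    (hq1 : ∀ i, ∑ z, qb i z = 1) (hW : ∀ i z, pb i z ≤ W i * qb i z)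
    {zs : Fin m → Z} (hzs : ∀ i, pb i (zs i) = W i * qb i (zs i)) {t : ℕ} {ε : ℝ}
    (h : tvDist (lawAt (imhKernel (blockProd pb) (blockProd qb)) (Pi.single zs 1) t)
      (blockProd pb) ≤ ε) :
    (∏ i, W i) * (1 - blockProd pb zs - ε) ≤ t * (1 - blockProd pb zs) :=
  imh_mixing_time_ge (blockProd_pos hp) (sum_blockProd_eq_one hp1) (blockProd_nonneg hq)
    (sum_blockProd_eq_one hq1) (blockProd_le_prod_mul_blockProd (fun i z => (hp i z).le) hW)
    (blockProd_eq_prod_mul_blockProd_of_modes hzs) h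

/-- **V2 for `m` identical blocks: relaxation time `≳ W₁^m = w⋆₁^{V/V₀}`.**  For a one-block
target `p₀` and model `q₀` with `p₀ ≤ W₁·q₀` attained at `z⋆`, the exact flow-MCMC chain for
`m` independent copies started at the product mode satisfies
`W₁^m · (1 − p₀(z⋆)^m − ε) ≤ t · (1 − p₀(z⋆)^m)` whenever it is `ε`-close at time `t`:
exponential in the number of blocks at fixed local model quality `W₁ > 1` — the typed form of
barrier B1 for full-lattice independence samplers (lead's V2). [folklore] -/
theorem imh_blockProd_const_mixing_time_ge {p₀ q₀ : Z → ℝ} {W₁ : ℝ} (hp : ∀ z, 0 < p₀ z)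
    (hp1 : ∑ z, p₀ z = 1) (hq : ∀ z, 0 ≤ q₀ z) (hq1 : ∑ z, q₀ z = 1)
    (hW : ∀ z, p₀ z ≤ W₁ * q₀ z) {zs : Z} (hzs : p₀ zs = W₁ * q₀ zs) (m : ℕ) {t : ℕ} {ε : ℝ}
    (h : tvDist (lawAt (imhKernel (blockProd fun _ : Fin m => p₀) (blockProd fun _ : Fin m => q₀))
      (Pi.single (fun _ => zs) 1) t) (blockProd fun _ : Fin m => p₀) ≤ ε) :
    W₁ ^ m * (1 - p₀ zs ^ m - ε) ≤ t * (1 - p₀ zs ^ m) := by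
  have key := imh_blockProd_mixing_time_ge (pb := fun _ : Fin m => p₀) (qb := fun _ => q₀)
    (W := fun _ => W₁) (zs := fun _ => zs) (fun _ => hp) (fun _ => hp1) (fun _ => hq)
    (fun _ => hq1) (fun _ => hW) (fun _ => hzs) h
  have e1 : blockProd (fun _ : Fin m => p₀) (fun _ => zs) = p₀ zs ^ m := by
    unfold blockProd; rw [Fin.prod_const]
  rw [Fin.prod_const, e1] at key
  exact key

end Blocks

end Summit.Ventures.LatticeQCDFlow.Theory2
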